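import Summits.Ventures.PercRepro.C025ProfileThinHallAll
import Summits.Ventures.PercRepro.C025ProfileThreeFour
import Summits.Ventures.PercRepro.C025ProfileThreeFourHall

/-!
# THE ROW `(q+1, q+2)` OF (Π) AND ITS HALL FORM ON EVERY MATROID REDUCE TO THE SIMPLE MATROIDS (night-3 g17)
The single-element steps of the row and of its Hall form (`profileIneq_of_isLoop` / `profileIneq_of_parallel`,
`hallIneq_of_isLoop` / `hallIneq_of_parallel`) hold on EVERY finite matroid; a strong induction on `|E|` therefore reduces the row
`(q+1, q+2)` for every matroid to the row `(q+1, q+2)` for SIMPLE matroids, given the previous row `(q, q+1)` for every matroid (the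
parallel-pair step lands in the contraction `(M ／ {x}) ＼ {y}` at level `q`):
* **`profileIneq_succ_of_simple`** / **`hallIneq_succ_of_simple`** — the reduction theorems;
* **`profileIneq_four_five_of_simple`** / **`hallIneq_four_five_of_simple`** — with the tree's row `(3, 4)` on every matroid
  (`profileIneq_three_four` / `hallIneq_three_four`, night-3 g12 + p10): the row `(4, 5)` of C-032 and its Hall form (C-033) on EVERY
  finite matroid follow from their SIMPLE case — the first open row of the conjecture is a statement about simple matroids only
  (p10's Theorem A did this at `q = 3`; here it is every `q`).
No `def`, no `instance`, no notation.  Axioms: standard.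
-/
open scoped Matroid
namespace PercRepro
open Set Finset ThmH Staged
namespace ThinGirth
variable {α : Type} [DecidableEq α]

/-- **The row `(q+1, q+2)` on every matroid from its simple case**, given the row `(q, q+1)` on every matroid. -/
theorem profileIneq_succ_of_simple (q : ℕ)
    (hprev : ∀ (N : Matroid α) [N.Finite], Profile.ProfileIneq N q (q + 1))
    (hsimple : ∀ (N : Matroid α) [N.Finite], (∀ T ⊆ N.E, T.encard ≤ 2 → N.Indep T) →
      Profile.ProfileIneq N (q + 1) (q + 1 + 1)) :
    ∀ (M : Matroid α) [M.Finite], Profile.ProfileIneq M (q + 1) (q + 1 + 1) := by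
  suffices H : ∀ n : ℕ, ∀ (M : Matroid α) [M.Finite], M.E.ncard = n → Profile.ProfileIneq M (q + 1) (q + 1 + 1) from
    fun M _ => H _ M rfl
  intro n
  induction n using Nat.strong_induction_on with
  | _ n ih =>
  intro M _ hn
  have hdel : ∀ e ∈ M.E, (M ＼ {e}).E.ncard < n := by
    intro e he
    rw [Matroid.delete_ground, ← hn, ← Set.ncard_sdiff_singleton_add_one he M.ground_finite]
    omega
  by_cases hloop : ∃ e, M.IsLoop e
  · obtain ⟨e, he⟩ := hloop
    exact profileIneq_of_isLoop he (ih _ (hdel e he.mem_ground) (M ＼ {e}) rfl)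
  have hnl : ∀ x ∈ M.E, M.Indep {x} := by
    intro x hx
    exact Matroid.indep_singleton.2 ((Matroid.not_isLoop_iff hx).1 (fun h => hloop ⟨x, h⟩))
  by_cases hs : ∀ T ⊆ M.E, T.encard ≤ 2 → M.Indep T
  · exact hsimple M hs
  obtain ⟨e, e', heE, he'E, hne, _, hpar'⟩ := exists_parallel_of_not_simple hnl hs
  exact profileIneq_of_parallel (hnl e heE) (hnl e' he'E) hne.symm hpar' q
    (ih _ (hdel e' he'E) (M ＼ {e'}) rfl) (hprev ((M ／ {e}) ＼ {e'}))

/-- **The Hall form `(H⁺_{q+1,q+2})` on every matroid from its simple case**, given `(H⁺_{q,q+1})` on every matroid. -/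
theorem hallIneq_succ_of_simple (q : ℕ)
    (hprev : ∀ (N : Matroid α) [N.Finite], Profile.HallIneq N q (q + 1))
    (hsimple : ∀ (N : Matroid α) [N.Finite], (∀ T ⊆ N.E, T.encard ≤ 2 → N.Indep T) →
      Profile.HallIneq N (q + 1) (q + 1 + 1)) :
    ∀ (M : Matroid α) [M.Finite], Profile.HallIneq M (q + 1) (q + 1 + 1) := by
  suffices H : ∀ n : ℕ, ∀ (M : Matroid α) [M.Finite], M.E.ncard = n → Profile.HallIneq M (q + 1) (q + 1 + 1) from
    fun M _ => H _ M rfl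
  intro n
  induction n using Nat.strong_induction_on with
  | _ n ih =>
  intro M _ hn
  have hdel : ∀ e ∈ M.E, (M ＼ {e}).E.ncard < n := by
    intro e he
    rw [Matroid.delete_ground, ← hn, ← Set.ncard_sdiff_singleton_add_one he M.ground_finite]
    omega
  by_cases hloop : ∃ e, M.IsLoop e
  · obtain ⟨e, he⟩ := hloop
    exact hallIneq_of_isLoop he (ih _ (hdel e he.mem_ground) (M ＼ {e}) rfl)
  have hnl : ∀ x ∈ M.E, M.Indep {x} := by
    intro x hx
    exact Matroid.indep_singleton.2 ((Matroid.not_isLoop_iff hx).1 (fun h => hloop ⟨x, h⟩))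
  by_cases hs : ∀ T ⊆ M.E, T.encard ≤ 2 → M.Indep T
  · exact hsimple M hs
  obtain ⟨e, e', heE, he'E, hne, _, hpar'⟩ := exists_parallel_of_not_simple hnl hs
  exact hallIneq_of_parallel (hnl e heE) (hnl e' he'E) hne.symm hpar' q
    (ih _ (hdel e' he'E) (M ＼ {e'}) rfl) (hprev ((M ／ {e}) ＼ {e'}))

/-- **The row `(4, 5)` of C-032 on every finite matroid follows from its simple case** (the row `(3, 4)` on every matroid is the
tree's `profileIneq_three_four`). -/
theorem profileIneq_four_five_of_simple
    (hsimple : ∀ (N : Matroid α) [N.Finite], (∀ T ⊆ N.E, T.encard ≤ 2 → N.Indep T) → Profile.ProfileIneq N 4 5) :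
    ∀ (M : Matroid α) [M.Finite], Profile.ProfileIneq M 4 5 :=
  profileIneq_succ_of_simple 3 (fun N _ => profileIneq_three_four N) hsimple

/-- **The Hall form `(H⁺_{4,5})` (C-033) on every finite matroid follows from its simple case** (`(H⁺_{3,4})` on every matroid is the
tree's `hallIneq_three_four`). -/
theorem hallIneq_four_five_of_simple
    (hsimple : ∀ (N : Matroid α) [N.Finite], (∀ T ⊆ N.E, T.encard ≤ 2 → N.Indep T) → Profile.HallIneq N 4 5) :
    ∀ (M : Matroid α) [M.Finite], Profile.HallIneq M 4 5 :=
  hallIneq_succ_of_simple 3 (fun N _ => hallIneq_three_four N) hsimple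

end ThinGirth
end PercRepro
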